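import Summits.QuantumFields.YangMills.Theorems.PencilRigidityHypercubicLimitDefs
import Summits.QuantumFields.YangMills.Theorems.PencilRigidityHypercubicLimitScaledPlaneLimits
import Summits.QuantumFields.YangMills.Theorems.PencilRigidityHypercubicLimitOneFieldFromPlanes
import Summits.QuantumFields.YangMills.Theorems.PencilRigidityHypercubicLimitTranslateScaledLimit
import Summits.QuantumFields.YangMills.Theorems.LangevinControlUVOSLegsFromFemtoAndGapStubAssemblyDensityExpansion
import Summits.QuantumFields.YangMills.Theorems.LangevinControlUVOSLegsFromFemtoAndGapStubAssemblyInheritance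
import Summits.QuantumFields.YangMills.Theorems.LangevinControlUVOSLegsFromFemtoAndGapStubAssemblyLowDegree
import HarnessLib

/-!
# Crux `HypercubicLimit` (stmt-QuantumFields-8646), line `conditional-mean-telescoping`: sub-goal `softWitnessU`

Support file (`--supports stmt-QuantumFields-8646`, c2 seat; leg (S) `stub_softLegs` of the closure, reshape 3): the
WITNESS of `SoftData` along given scheme sequences.  From couplings `β_k → ∞`, spacings `a_k = m(β_k) → 0`
(`≤ 1/24`), tori `L_k ≥ a_k⁻²` with `a_k L_k → ∞` serving the torus demand `Λ(β_k, i)` (`i ≤ k`), positive reference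
squares `N_k` with `N_k^{-1/2} ≤ a_k^{-Q}`, and the a-uniform bound of leg (U) at step `k` for arities `n ≤ k`:
the subsequence and plane-string limits of `scaledPlaneLimits`, the one-field family of `oneFieldFromPlanes`, the
scheme `sch = (a, β, L, c = N^{-1/2}, m = torus means) ∘ φ`, and the clauses `SoftData r m δ₀ Λ sch S₁ Spl`,
the renormalisation clause `c_k ≤ a_k^{-Q}` (`PolyRenorm` of the vocabulary file B, unfolded so that this file does
not wait for it), E0, E0′, E3, invariance under all translations on `⁰𝒮` (`translate_scaledLimit`), and the one-field
convergence clause (`latticeSchwinger = (c a⁴)ⁿ latticeDist`, plane expansion `latticeDist_dens_eq_sum_latticeDistStr`).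
-/

set_option autoImplicit false

noncomputable section

open scoped SchwartzMap BigOperators
open MeasureTheory Filter Topology
open Literature.MathematicalPhysics.QuantumFieldTheory Literature.MathematicalPhysics.QuantumLattice
open Literature.MathematicalPhysics.AQFT
open Literature.Probability.LatticeModels (box Site)
open Summit.QuantumFields.YangMills.Theorems.OSLegsFromFemtoAndGap

namespace Summit.QuantumFields.YangMills.Cruxes.HypercubicLimit.ConditionalMeanTelescoping

/-- **`softWitnessU`** (registered sub-goal of crux stmt-QuantumFields-8646, c2 seat): the `SoftData` witness along given
scheme sequences — see the module docstring. -/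
theorem softWitnessU :
    ∀ (G : Type) [Group G] [TopologicalSpace G] [IsTopologicalGroup G] [CompactSpace G] [MeasurableSpace G]
      [BorelSpace G] (r : LatticeRep G) (m : ℝ → ℝ) (δ₀ : ℝ) (Λ : ℝ → ℕ → ℕ) (βs : ℕ → ℝ) (Ls : ℕ → ℕ)
      (K : ℝ) (γ s Q : ℕ),
      0 ≤ K → (∀ k, 0 < m (βs k)) → (∀ k, m (βs k) ≤ 1 / 24) → Tendsto (fun k => m (βs k)) atTop (𝓝 0) →
      Tendsto βs atTop atTop → (∀ k, (m (βs k))⁻¹ * (m (βs k))⁻¹ ≤ (Ls k : ℝ)) →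
      Tendsto (fun k => m (βs k) * Ls k) atTop atTop → (∀ k i : ℕ, i ≤ k → Λ (βs k) i ≤ Ls k) →
      (∀ k, 0 < refSquare r (βs k) (Ls k) δ₀ (m (βs k))) →
      (∀ k, (Real.sqrt (refSquare r (βs k) (Ls k) δ₀ (m (βs k))))⁻¹ ≤ ((m (βs k))⁻¹) ^ Q) →
      (∀ n : ℕ, 2 ≤ n → ∀ k : ℕ, n ≤ k → ∀ q : Fin n → Fin 4 × Fin 4, (∀ i, (q i).1 ≠ (q i).2) →
        ∀ (y : (Fin n → Site 4) → (Fin n → EuclideanSpace ℝ (Fin 4))),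
          (∀ x l, ‖y x l - m (βs k) • siteToE (x l)‖ ≤ 6 * m (βs k)) →
          ∀ F : 𝓢((Fin n → EuclideanSpace ℝ (Fin 4)), ℂ), IsOffDiagonal F →
            m (βs k) ^ (4 * n) * ‖∑ x ∈ Fintype.piFinset (fun _ : Fin n => box 4 (Ls k)),
                ((planeWeight r (βs k) (Ls k) q x : ℝ) : ℂ) * F (y x)‖ ≤
              (K * (n : ℝ) ^ γ * Real.sqrt (refSquare r (βs k) (Ls k) δ₀ (m (βs k)))) ^ n *
                schwartzNorm (s * n) F) →
      ∃ φ : ℕ → ℕ, StrictMono φ ∧ ∃ (sch : SpeciesScheme (YMSpecies G)) (S₁ : SchwingerFamily (EuclideanSpace ℝ (Fin 4)))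
        (Spl : (n : ℕ) → (Fin n → Fin 4 × Fin 4) → (𝓢((Fin n → EuclideanSpace ℝ (Fin 4)), ℂ) →L[ℂ] ℂ)),
        (∀ k, sch.β k = βs (φ k)) ∧ (∀ k, sch.L k = Ls (φ k)) ∧ (∀ k, sch.a k = m (βs (φ k))) ∧
        (∀ k, sch.c r.curvature k = (Real.sqrt (refSquare r (βs (φ k)) (Ls (φ k)) δ₀ (m (βs (φ k)))))⁻¹) ∧
        SoftData r m δ₀ Λ sch S₁ Spl ∧ (∃ Q' : ℕ, ∀ k, sch.c r.curvature k ≤ ((sch.a k)⁻¹) ^ Q') ∧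
        S₁.toLabelled.IsNormalized ∧ S₁.toLabelled.HasLinearGrowth ∧ S₁.toLabelled.IsSymmetric ∧
        (∀ (n : ℕ) (k : Fin n → Unit) (t : EuclideanSpace ℝ (Fin 4)) (F : 𝓢((Fin n → EuclideanSpace ℝ (Fin 4)), ℂ)),
          IsOffDiagonal F → S₁.toLabelled n k (translateMulti t F) = S₁.toLabelled n k F) ∧
        (∀ (n : ℕ), n ≠ 0 → ∀ (f : Fin n → 𝓢(EuclideanSpace ℝ (Fin 4), ℝ))
          (F : 𝓢((Fin n → EuclideanSpace ℝ (Fin 4)), ℂ)), IsTensorOf F (fun i => ofRealTest (f i)) → IsOffDiagonal F →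
            Tendsto (fun k : ℕ => ((latticeSchwinger r.ρ sch (fun s => s.F) k n (fun _ => r.curvature) f : ℝ) : ℂ))
              atTop (𝓝 (S₁ n F))) := by
  intro G _ _ _ _ _ _ r m δ₀ Λ βs Ls K γ s Q hK hmpos hm24 hmlim hβlim hLa hgrow hΛ hNpos hNQ hU
  classical
  -- notation: spacings, reference squares, the normalising scalar
  set as : ℕ → ℝ := fun k => m (βs k) with has
  set Ns : ℕ → ℝ := fun k => refSquare r (βs k) (Ls k) δ₀ (m (βs k)) with hNs
  have ha1 : ∀ k, as k ≤ 1 := fun k => (hm24 k).trans (by norm_num)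
  /- 1. the subsequence and the plane-string limits -/
  have hshift0 : ∀ (k : ℕ) {n : ℕ} (x : Fin n → Site 4) (l : Fin n),
      ‖(fun i => as k • siteToE (x i)) l - as k • siteToE (x l)‖ ≤ 6 * as k := by
    intro k n x l
    rw [sub_self, norm_zero]; exact mul_nonneg (by norm_num) (hmpos k).le
  obtain ⟨φ, hφ, Spl₀, hSbd, hSconv, hSE3⟩ := scaledPlaneLimits G r βs Ls as Ns K γ s hK hNpos
    (fun n hn k hk q hq F hF => hU n hn k hk q hq (fun x i => as k • siteToE (x i)) (fun x l => hshift0 k x l) F hF)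
  have hφk : ∀ k, k ≤ φ k := fun k => hφ.id_le k
  -- the plane functionals: the limits on non-degenerate strings, zero on degenerate ones
  let Spl : (n : ℕ) → (Fin n → Fin 4 × Fin 4) → (𝓢((Fin n → EuclideanSpace ℝ (Fin 4)), ℂ) →L[ℂ] ℂ) :=
    fun n q => if ∀ i, (q i).1 ≠ (q i).2 then Spl₀ n q else 0
  have hSpl_of : ∀ n (q : Fin n → Fin 4 × Fin 4), (∀ i, (q i).1 ≠ (q i).2) → Spl n q = Spl₀ n q :=
    fun n q hq => if_pos hq
  have hSpl_not : ∀ n (q : Fin n → Fin 4 × Fin 4), ¬ (∀ i, (q i).1 ≠ (q i).2) → Spl n q = 0 :=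
    fun n q hq => if_neg hq
  have hSbd' : ∀ (n : ℕ) (q : Fin n → Fin 4 × Fin 4) (F : 𝓢((Fin n → EuclideanSpace ℝ (Fin 4)), ℂ)),
      ‖Spl n q F‖ ≤ (K * (n : ℝ) ^ γ) ^ n * schwartzNorm (s * n) F := by
    intro n q F
    by_cases hq : ∀ i, (q i).1 ≠ (q i).2
    · rw [hSpl_of n q hq]; exact hSbd n q F
    · rw [hSpl_not n q hq]; simpa using mul_nonneg (pow_nonneg (by positivity) n) (schwartzNorm_nonneg (s * n) F)
  have hSE3' : ∀ (n : ℕ) (q : Fin n → Fin 4 × Fin 4) (π : Equiv.Perm (Fin n))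
      (F : 𝓢((Fin n → EuclideanSpace ℝ (Fin 4)), ℂ)), IsOffDiagonal F → Spl n q (permTest π F) = Spl n (q ∘ π) F := by
    intro n q π F hF
    by_cases hq : ∀ i, (q i).1 ≠ (q i).2
    · have hq' : ∀ i, ((q ∘ π) i).1 ≠ ((q ∘ π) i).2 := fun i => hq (π i)
      rw [hSpl_of n q hq, hSpl_of n _ hq']; exact hSE3 n q π F hF
    · have hq' : ¬ ∀ i, ((q ∘ π) i).1 ≠ ((q ∘ π) i).2 := fun h => hq fun i => by simpa using h (π.symm i)
      rw [hSpl_not n q hq, hSpl_not n _ hq']; rfl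
  /- 2. the one-field family -/
  obtain ⟨S₁, h0, h1, h2, hbd1, hE0, hE0', hE3S⟩ := oneFieldFromPlanes Spl K γ s hK hSbd' hSE3'
  /- 3. the scheme along `φ` -/
  let sch : SpeciesScheme (YMSpecies G) :=
    { a := fun j => as (φ j)
      a_pos := fun j => hmpos _
      tendsto_a := hmlim.comp hφ.tendsto_atTop
      β := fun j => βs (φ j)
      L := fun j => Ls (φ j)
      tendsto_L := hgrow.comp hφ.tendsto_atTop
      c := fun _ j => (Real.sqrt (Ns (φ j)))⁻¹
      m := fun sp j => wilsonTorusMean r.ρ (βs (φ j)) (Ls (φ j)) sp.F }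
  have hsch_c : ∀ j, sch.c r.curvature j * sch.a j ^ 4 = (Real.sqrt (Ns (φ j)))⁻¹ * as (φ j) ^ 4 := fun j => rfl
  /- 4. convergence of the normalised density distributions (plane expansion) -/
  have hplanes_eq : ∀ (n : ℕ) (q : Fin n → Fin 4 × Fin 4),
      (fun i U => plaquetteObs r.ρ 0 (q i).1 (q i).2 U : Fin n → LGConfig 4 G → ℝ) = fun i => planeObs r (q i) :=
    fun n q => rfl
  have hconvS₁ : ∀ (n : ℕ) (F : 𝓢((Fin n → EuclideanSpace ℝ (Fin 4)), ℂ)), IsOffDiagonal F →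
      Tendsto (fun k => (((sch.c r.curvature k * sch.a k ^ 4) ^ n : ℝ) : ℂ) *
        latticeDist r.ρ (sch.β k) (sch.L k) (sch.a k) r.curvature.F
          (wilsonTorusMean r.ρ (sch.β k) (sch.L k) r.curvature.F) n F) atTop (𝓝 (S₁ n F)) := by
    intro n F hF
    rcases Nat.lt_or_ge n 2 with hn | hn
    · interval_cases n
      · simp_rw [pow_zero, Complex.ofReal_one, one_mul]
        change Tendsto (fun k => latticeDist r.ρ (βs (φ k)) (Ls (φ k)) (as (φ k)) r.curvature.F _ 0 F) atTop _
        simp_rw [latticeDist_zero_apply r.ρ r.continuous, h0]; exact tendsto_const_nhds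
      · change Tendsto (fun k => (((sch.c r.curvature k * sch.a k ^ 4) ^ 1 : ℝ) : ℂ) *
          latticeDist r.ρ (βs (φ k)) (Ls (φ k)) (as (φ k)) r.curvature.F
            (wilsonTorusMean r.ρ (βs (φ k)) (Ls (φ k)) r.curvature.F) 1 F) atTop _
        simp_rw [latticeDist_one_apply, mul_zero, h1]; exact tendsto_const_nhds
    · rw [h2 n hn]
      change Tendsto (fun k => (((sch.c r.curvature k * sch.a k ^ 4) ^ n : ℝ) : ℂ) *
        latticeDist r.ρ (βs (φ k)) (Ls (φ k)) (as (φ k)) r.curvature.F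
          (wilsonTorusMean r.ρ (βs (φ k)) (Ls (φ k)) r.curvature.F) n F) atTop _
      simp_rw [latticeDist_dens_eq_sum_latticeDistStr, Finset.mul_sum, hplanes_eq]
      refine tendsto_finsetSum _ fun q hq => ?_
      have hq' : ∀ i, (q i).1 ≠ (q i).2 := fun i => ((mem_planeStrings_iff q).1 hq i).ne
      rw [hSpl_of n q hq']
      exact hSconv n q hq' F hF
  /- 5. the k-uniform bound along the scheme, at shifted points -/
  have hUsch : ∀ n : ℕ, 2 ≤ n → ∀ᶠ k in atTop, ∀ (q : Fin n → Fin 4 × Fin 4), (∀ i, (q i).1 ≠ (q i).2) →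
      ∀ (y : (Fin n → Site 4) → (Fin n → EuclideanSpace ℝ (Fin 4))),
        (∀ x l, ‖y x l - sch.a k • siteToE (x l)‖ ≤ 6 * sch.a k) →
        ∀ F : 𝓢((Fin n → EuclideanSpace ℝ (Fin 4)), ℂ), IsOffDiagonal F →
          (sch.c r.curvature k * sch.a k ^ 4) ^ n *
              ‖∑ x ∈ Fintype.piFinset (fun _ : Fin n => box 4 (sch.L k)),
                  ((planeWeight r (sch.β k) (sch.L k) q x : ℝ) : ℂ) * F (y x)‖ ≤
            (K * (n : ℝ) ^ γ) ^ n * schwartzNorm (s * n) F := by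
    intro n hn
    filter_upwards [eventually_ge_atTop n] with k hk q hq y hy F hF
    have h1 := hU n hn (φ k) (hk.trans (hφk k)) q hq y hy F hF
    have hsq : 0 < Real.sqrt (Ns (φ k)) := Real.sqrt_pos.2 (hNpos _)
    rw [hsch_c, mul_pow, ← pow_mul, mul_comm 4 n, mul_assoc]
    calc (Real.sqrt (Ns (φ k)))⁻¹ ^ n * (as (φ k) ^ (n * 4) * ‖∑ x ∈ Fintype.piFinset (fun _ : Fin n => box 4 (sch.L k)),
            ((planeWeight r (sch.β k) (sch.L k) q x : ℝ) : ℂ) * F (y x)‖)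
        ≤ (Real.sqrt (Ns (φ k)))⁻¹ ^ n * ((K * (n : ℝ) ^ γ * Real.sqrt (Ns (φ k))) ^ n * schwartzNorm (s * n) F) := by
          refine mul_le_mul_of_nonneg_left ?_ (by positivity)
          rw [mul_comm n 4]; exact h1
      _ = (K * (n : ℝ) ^ γ) ^ n * schwartzNorm (s * n) F := by
          rw [mul_pow (K * (n : ℝ) ^ γ), ← mul_assoc, ← mul_assoc, mul_comm ((Real.sqrt (Ns (φ k)))⁻¹ ^ n),
            mul_assoc ((K * (n : ℝ) ^ γ) ^ n), ← mul_pow, inv_mul_cancel₀ hsq.ne', one_pow, mul_one]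
  /- 6. translations on `⁰𝒮` -/
  have hlam : ∀ n k, |(sch.c r.curvature k * sch.a k ^ 4) ^ n| ≤ ((sch.a k)⁻¹) ^ (Q * n) := by
    intro n k
    have hc0 : 0 ≤ sch.c r.curvature k := by change 0 ≤ (Real.sqrt (Ns (φ k)))⁻¹; positivity
    have ha0 : 0 ≤ sch.a k := (hmpos _).le
    rw [abs_of_nonneg (pow_nonneg (mul_nonneg hc0 (pow_nonneg ha0 4)) n), pow_mul]
    refine pow_le_pow_left₀ (mul_nonneg hc0 (pow_nonneg ha0 4)) ?_ n
    calc sch.c r.curvature k * sch.a k ^ 4 ≤ sch.c r.curvature k * 1 :=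
          mul_le_mul_of_nonneg_left (pow_le_one₀ ha0 (ha1 _)) hc0
      _ ≤ ((sch.a k)⁻¹) ^ Q := by rw [mul_one]; exact hNQ (φ k)
  have htransSpl : ∀ (n : ℕ) (q : Fin n → Fin 4 × Fin 4) (t : EuclideanSpace ℝ (Fin 4))
      (F : 𝓢((Fin n → EuclideanSpace ℝ (Fin 4)), ℂ)), IsOffDiagonal F → Spl n q (translateMulti t F) = Spl n q F := by
    intro n q t F hF
    by_cases hq : ∀ i, (q i).1 ≠ (q i).2
    · rw [hSpl_of n q hq]
      rcases Nat.lt_or_ge n 2 with hn | hn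
      · -- arities 0, 1: the limit functionals are explicit on `⁰𝒮`
        have hlim := hSconv n q hq
        interval_cases n
        · refine tendsto_nhds_unique (hlim _ (hF.translateMulti t)) ((hlim F hF).congr fun k => ?_)
          simp only [pow_zero, Complex.ofReal_one, one_mul, latticeDistStr_apply]
          refine Finset.sum_congr rfl fun x _ => ?_
          rw [translateMulti_apply]; congr 2; exact funext fun i => Fin.elim0 i
        · refine tendsto_nhds_unique (hlim _ (hF.translateMulti t)) ((hlim F hF).congr fun k => ?_)
          rw [latticeDistStr_planeObs_one, latticeDistStr_planeObs_one]
      · refine translate_scaledLimit G r n q (fun k => βs (φ k)) (fun k => Ls (φ k)) (fun k => as (φ k))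
          (fun k => (sch.c r.curvature k * sch.a k ^ 4) ^ n) (Q * n) (s * n) ((K * (n : ℝ) ^ γ) ^ n) (Spl₀ n q)
          (fun k => hmpos _) (fun k => ha1 _) (hmlim.comp hφ.tendsto_atTop) (fun k => hLa _) (hlam n) ?_
          (fun F hF => hSconv n q hq F hF) t F hF
        filter_upwards [hUsch n hn] with k hk F hF
        have h := hk q hq (fun x i => sch.a k • siteToE (x i)) (fun x l => hshift0 (φ k) x l) F hF
        rw [norm_mul, Complex.norm_real, Real.norm_eq_abs, abs_of_nonneg, latticeDistStr_planeObs_apply]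
        · exact h
        · exact pow_nonneg (mul_nonneg (by change 0 ≤ (Real.sqrt (Ns (φ k)))⁻¹; positivity)
            (pow_nonneg (hmpos _).le 4)) n
    · rw [hSpl_not n q hq]; rfl
  have htransS₁ : ∀ (n : ℕ) (k : Fin n → Unit) (t : EuclideanSpace ℝ (Fin 4))
      (F : 𝓢((Fin n → EuclideanSpace ℝ (Fin 4)), ℂ)), IsOffDiagonal F →
        S₁.toLabelled n k (translateMulti t F) = S₁.toLabelled n k F := by
    intro n k t F hF
    simp only [SchwingerFamily.toLabelled_apply]
    rcases Nat.lt_or_ge n 2 with hn | hn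
    · interval_cases n
      · rw [h0, h0, translateMulti_apply]; congr 1; exact funext fun i => Fin.elim0 i
      · rw [h1, h1]
    · rw [h2 n hn, h2 n hn]
      exact Finset.sum_congr rfl fun q _ => htransSpl n q t F hF
  /- 7. the one-field convergence clause -/
  have hYM : ∀ (n : ℕ), n ≠ 0 → ∀ (f : Fin n → 𝓢(EuclideanSpace ℝ (Fin 4), ℝ))
      (F : 𝓢((Fin n → EuclideanSpace ℝ (Fin 4)), ℂ)), IsTensorOf F (fun i => ofRealTest (f i)) → IsOffDiagonal F →
        Tendsto (fun k : ℕ => ((latticeSchwinger r.ρ sch (fun s => s.F) k n (fun _ => r.curvature) f : ℝ) : ℂ))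
          atTop (𝓝 (S₁ n F)) := by
    intro n _ f F hF hod
    refine (hconvS₁ n F hod).congr fun k => ?_
    rw [latticeSchwinger_eq_latticeDist r sch r.curvature k n f F hF]
  /- 8. assemble `SoftData`, `PolyRenorm` and the soft clauses -/
  refine ⟨φ, hφ, sch, S₁, Spl, fun k => rfl, fun k => rfl, fun k => rfl, fun k => rfl, ?_, ⟨Q, fun k => ?_⟩,
    hE0, hE0', hE3S, htransS₁, hYM⟩
  · refine ⟨fun k => rfl, hβlim.comp hφ.tendsto_atTop, fun k => hΛ (φ k) k (hφk k), fun k => hNpos (φ k),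
      fun k => rfl, fun k => rfl, ?_, hconvS₁, fun n hn F _ => h2 n hn F, h0, h1,
      ⟨K, γ, s, hK, hUsch, hSbd', hbd1⟩, hSE3', htransSpl⟩
    intro n q hq F hF
    rw [hSpl_of n q hq]
    exact hSconv n q hq F hF
  · change (Real.sqrt (Ns (φ k)))⁻¹ ≤ ((as (φ k))⁻¹) ^ Q
    exact hNQ (φ k)

end Summit.QuantumFields.YangMills.Cruxes.HypercubicLimit.ConditionalMeanTelescoping

end
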